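import Summits.QuantumFields.YangMills.Theorems.BalabanLadderUVSeamRecResponseMomentsPinning
import HarnessLib

/-!
# Crux `UVSeamRec` (stmt-QuantumFields-20043): a bounded COLOURING of cyclically separated families on the odd torus — the
# combinatorial half of «the separation scale is immaterial for (RM)»

Helper file (`--supports stmt-QuantumFields-20043`) of the stub-helper seat `ym-20043-seam-s2` (lane S-A, gen 2).  The binders
(RM)/(PM)/(AM)/`MomentBounds6` quantify over families of sites `x i ∈ ℤ⁴` read on the odd torus `(ℤ/(2L+1))⁴` that are pairwise
CYCLICALLY `s`-SEPARATED IN SOME COORDINATE (`s = 2R+4`): `∃ k, s ≤ |valMinAbs((x i k − x j k : ℤ) : ZMod (2L+1))|`.  This file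
proves, for every multiplier `m`, that such a family splits into at most `(4m+4)⁴` classes (a colour vector in `{0,…,4m+3}⁴`
computed coordinatewise from the residues) such that two distinct members OF THE SAME CLASS are cyclically `m·s`-separated in some
coordinate (`sparse_of_colour_eq`).  The sequel `…ResponseMomentsSparsification.lean` turns this, by convexity of `exp`, into:
(RM) for `m(2R+4)`-separated families ⇒ (RM) for `2R+4`-separated families with `C₁ ↦ (4m+4)⁴·C₁`.

Construction (one coordinate, residues `z : ZMod N`, `N = 2L+1 ≥ s ≥ 1`): cut the cycle into `M = ⌈N/s⌉ = (N+s−1)/s` ARCS by the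
index `J(v) = ⌊v·M/N⌋ ∈ {0,…,M−1}` of the value `v = val z` (arcs are shorter than `s`, so `s`-separated residues lie in different
arcs; arcs at cyclic index distance `≥ D` hold residues at cyclic distance `> (D−1)N/M`); colour the arc indices by `j mod D` on the
initial segment `j < M − (M mod D)` and by FRESH colours `D + (j − (M − M mod D))` on the `< D` remaining indices, so that equal
colours force cyclic index distance `≥ D`; take `D = 2m+2`.  To keep this file free of definitions the arc count `M` and the
colouring `c` enter the lemmas through their defining equations (`hM`, `hc`).

* §1 `natAbs_valMinAbs_sub_eq_min` — `|valMinAbs(z − w)| = min(d, N − d)`, `d = |val z − val w|`.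
* §2 arcs: `numArcs_mul_bounds`, `one_le_numArcs`, `arcIdx_lt`, `arcIdx_mono`, `sub_lt_of_arcIdx_eq`, `mul_gt_of_arcIdx_le`,
  `mul_gt_of_arcIdx_wrap`.
* §3 colours: `arcColour_lt`, `cyclicFar_of_arcColour_eq`.
* §4 one coordinate: `far_vals_of_colour_eq`, **`sep_mul_of_coordColour_eq`**; §5 four coordinates: **`sparse_of_colour_eq`**.

HONEST FRAMING: finite combinatorics; nothing about the measure, E0′ or the gap.

References: none (elementary).
-/

set_option autoImplicit false

namespace Summit.QuantumFields.YangMills.Cruxes.UVSeamRec.ResponsePinning.Sparse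

/-! ## §1 The cyclic distance of two residues -/

/-- **Cyclic distance.**  For residues `z, w : ZMod N`: `|valMinAbs(z − w)| = min(d, N − d)` with `d = |val z − val w|`.
[folklore] -/
theorem natAbs_valMinAbs_sub_eq_min {N : ℕ} [NeZero N] (z w : ZMod N) :
    ((z - w).valMinAbs).natAbs = min (Int.natAbs ((z.val : ℤ) - w.val)) (N - Int.natAbs ((z.val : ℤ) - w.val)) := by
  rcases le_total w.val z.val with h | h
  · have hv : (z - w).val = z.val - w.val := ZMod.val_sub h
    have hd : Int.natAbs ((z.val : ℤ) - w.val) = z.val - w.val := by omega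
    rw [ZMod.valMinAbs_natAbs_eq_min, hv, hd]
  · have hv : (w - z).val = w.val - z.val := ZMod.val_sub h
    have hd : Int.natAbs ((z.val : ℤ) - w.val) = w.val - z.val := by omega
    rw [show z - w = -(w - z) by ring, ZMod.natAbs_valMinAbs_neg, ZMod.valMinAbs_natAbs_eq_min, hv, hd]

/-! ## §2 Arcs of the cycle `ℤ/N` of length `< s` (arc count `M = (N+s−1)/s`, arc index `⌊v·M/N⌋`) -/

/-- `s·M ≥ N` and `s·M ≤ N + s − 1` for `M = ⌈N/s⌉`, `s ≥ 1`. [folklore] -/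
theorem numArcs_mul_bounds {N s M : ℕ} (hs : 1 ≤ s) (hM : M = (N + s - 1) / s) :
    N ≤ s * M ∧ s * M ≤ N + s - 1 := by
  subst hM
  have h1 := Nat.div_add_mod (N + s - 1) s
  have h2 := Nat.mod_lt (N + s - 1) (by omega : 0 < s)
  constructor <;> omega

/-- `M ≥ 1` when `N ≥ 1`. [folklore] -/
theorem one_le_numArcs {N s M : ℕ} (hs : 1 ≤ s) (hN : 1 ≤ N) (hM : M = (N + s - 1) / s) : 1 ≤ M := by
  have h := (numArcs_mul_bounds (N := N) hs hM).1
  rcases Nat.eq_zero_or_pos M with h0 | h0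
  · rw [h0, mul_zero] at h; omega
  · exact h0

/-- Arc indices are `< M`. [folklore] -/
theorem arcIdx_lt {N s M v : ℕ} (hs : 1 ≤ s) (hM : M = (N + s - 1) / s) (hv : v < N) : v * M / N < M := by
  have hN : 0 < N := by omega
  have hM1 := one_le_numArcs hs (show 1 ≤ N by omega) hM
  rw [Nat.div_lt_iff_lt_mul hN]
  calc v * M < N * M := Nat.mul_lt_mul_of_pos_right hv (by omega)
    _ = M * N := mul_comm _ _

/-- Arc indices are monotone in the value. [folklore] -/
theorem arcIdx_mono {N M v w : ℕ} (h : v ≤ w) : v * M / N ≤ w * M / N :=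
  Nat.div_le_div_right (Nat.mul_le_mul_right _ h)

/-- **Arcs are shorter than `s`**: two values with the same arc index differ by `< s`. [folklore] -/
theorem sub_lt_of_arcIdx_eq {N s M v w : ℕ} (hs : 1 ≤ s) (hM : M = (N + s - 1) / s) (hvw : v ≤ w) (hw : w < N)
    (h : v * M / N = w * M / N) : w - v < s := by
  have hN : 0 < N := by omega
  have hMs := (numArcs_mul_bounds (N := N) hs hM).1
  -- `⌊vM/N⌋ = ⌊wM/N⌋` forces `wM − vM < N`
  have e1 := Nat.div_add_mod (v * M) N
  have e2 := Nat.div_add_mod (w * M) N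
  have r1 := Nat.mod_lt (v * M) hN
  have r2 := Nat.mod_lt (w * M) hN
  rw [h] at e1
  have hvm : v * M ≤ w * M := Nat.mul_le_mul_right _ hvw
  have hlt : w * M - v * M < N := by omega
  -- hence `(w − v)·M < s·M`, so `w − v < s`
  have h3 : (w - v) * M < s * M := by rw [Nat.sub_mul]; omega
  exact Nat.lt_of_mul_lt_mul_right h3

/-- **Far arcs hold far values (direct way).**  If `⌊wM/N⌋ ≥ ⌊vM/N⌋ + D` (`v ≤ w`, `D ≥ 1`) then `(w − v)·M > (D − 1)·N`.
[folklore] -/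
theorem mul_gt_of_arcIdx_le {N M v w D : ℕ} (hvw : v ≤ w) (hN : 0 < N) (hD : 1 ≤ D)
    (h : v * M / N + D ≤ w * M / N) : N * (D - 1) < (w - v) * M := by
  have e1 := Nat.div_add_mod (v * M) N
  have e2 := Nat.div_add_mod (w * M) N
  have r1 := Nat.mod_lt (v * M) hN
  have r2 := Nat.mod_lt (w * M) hN
  generalize ha : v * M / N = a at e1 h
  generalize hb : w * M / N = b at e2 h
  have h1 : N * a + N * D ≤ N * b := by rw [← Nat.mul_add]; exact Nat.mul_le_mul_left _ h
  have hND : N * (D - 1) + N = N * D := by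
    rw [Nat.mul_sub_one, Nat.sub_add_cancel (Nat.le_mul_of_pos_right N hD)]
  have hvm : v * M ≤ w * M := Nat.mul_le_mul_right _ hvw
  rw [Nat.sub_mul]
  omega

/-- **Far arcs hold far values (wrap-around way).**  If `⌊vM/N⌋ + M ≥ ⌊wM/N⌋ + D` (`v ≤ w < N`, `D ≥ 1`) then
`(N − (w − v))·M > (D − 1)·N`. [folklore] -/
theorem mul_gt_of_arcIdx_wrap {N M v w D : ℕ} (hvw : v ≤ w) (hw : w < N) (hN : 0 < N) (hD : 1 ≤ D)
    (h : w * M / N + D ≤ v * M / N + M) : N * (D - 1) < (N - (w - v)) * M := by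
  have e1 := Nat.div_add_mod (v * M) N
  have e2 := Nat.div_add_mod (w * M) N
  have r1 := Nat.mod_lt (v * M) hN
  have r2 := Nat.mod_lt (w * M) hN
  generalize ha : v * M / N = a at e1 h
  generalize hb : w * M / N = b at e2 h
  have h1 : N * b + N * D ≤ N * a + N * M := by rw [← Nat.mul_add, ← Nat.mul_add]; exact Nat.mul_le_mul_left _ h
  have hND : N * (D - 1) + N = N * D := by
    rw [Nat.mul_sub_one, Nat.sub_add_cancel (Nat.le_mul_of_pos_right N hD)]
  have hwm : w * M ≤ N * M := Nat.mul_le_mul_right _ hw.le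
  have hvm : v * M ≤ w * M := Nat.mul_le_mul_right _ hvw
  rw [Nat.sub_mul, Nat.sub_mul]
  omega

/-! ## §3 A proper colouring of the `D`-th power of the cycle of `M` arcs with fewer than `2D` colours -/

/-- Colours are `< 2D` (the colouring `c` is given by its defining equation `hc`). [folklore] -/
theorem arcColour_lt {M D : ℕ} (c : ℕ → ℕ)
    (hc : ∀ j, c j = if j < M - M % D then j % D else D + (j - (M - M % D))) (hD : 1 ≤ D) {j : ℕ} (hj : j < M) :
    c j < 2 * D := by
  rw [hc]
  have hr := Nat.mod_lt M (by omega : 0 < D)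
  split_ifs with h
  · have := Nat.mod_lt j (by omega : 0 < D); omega
  · omega

/-- **Equal colours force cyclic index distance `≥ D`.**  For `j < j' < M` with `c j = c j'`:
`D ≤ j' − j` and `D ≤ M − (j' − j)`. [folklore] -/
theorem cyclicFar_of_arcColour_eq {M D : ℕ} (c : ℕ → ℕ)
    (hc : ∀ j, c j = if j < M - M % D then j % D else D + (j - (M - M % D))) (hD : 1 ≤ D) {j j' : ℕ}
    (hjj : j < j') (hj' : j' < M) (hcc : c j = c j') : D ≤ j' - j ∧ D ≤ M - (j' - j) := by
  rw [hc, hc] at hcc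
  have hr := Nat.mod_lt M (by omega : 0 < D)
  have hP := Nat.div_add_mod M D
  set P := M - M % D with hPdef
  have hPd : D ∣ P := ⟨M / D, by omega⟩
  by_cases h1 : j < P
  · by_cases h2 : j' < P
    · rw [if_pos h1, if_pos h2] at hcc
      -- both periodic: `j ≡ j' (mod D)`, so `D ∣ j' − j` and `D ∣ P − (j' − j)`
      have hdvd : D ∣ j' - j := (Nat.modEq_iff_dvd' hjj.le).1 hcc
      have hge : D ≤ j' - j := Nat.le_of_dvd (by omega) hdvd
      have hdvd2 : D ∣ P - (j' - j) := Nat.dvd_sub hPd hdvd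
      have hge2 : D ≤ P - (j' - j) := Nat.le_of_dvd (by omega) hdvd2
      constructor <;> omega
    · rw [if_pos h1, if_neg h2] at hcc
      have := Nat.mod_lt j (by omega : 0 < D); omega
  · by_cases h2 : j' < P
    · omega
    · rw [if_neg h1, if_neg h2] at hcc; omega

/-! ## §4 One coordinate: equal colours upgrade `s`-separation to `m·s`-separation -/

/-- The core estimate in values: `v ≤ w < N`, `N ≥ s ≥ 1`, `s ≤ w − v`, equal arc colours (period `D = 2m+2`) ⇒
`m·s ≤ w − v` and `m·s ≤ N − (w − v)`. [folklore] -/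
theorem far_vals_of_colour_eq {N s m M v w : ℕ} (hs : 1 ≤ s) (hsN : s ≤ N) (hM : M = (N + s - 1) / s) (c : ℕ → ℕ)
    (hc : ∀ j, c j = if j < M - M % (2 * m + 2) then j % (2 * m + 2) else (2 * m + 2) + (j - (M - M % (2 * m + 2))))
    (hvw : v ≤ w) (hw : w < N) (hsep : s ≤ w - v) (hcc : c (v * M / N) = c (w * M / N)) :
    m * s ≤ w - v ∧ m * s ≤ N - (w - v) := by
  have hN : 0 < N := by omega
  obtain ⟨hMs, hMs'⟩ := numArcs_mul_bounds (N := N) hs hM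
  have hM1 := one_le_numArcs hs (show 1 ≤ N by omega) hM
  -- different arcs
  have hne : v * M / N ≠ w * M / N := fun h => by
    have := sub_lt_of_arcIdx_eq hs hM hvw hw h; omega
  have hlt : v * M / N < w * M / N := lt_of_le_of_ne (arcIdx_mono hvw) hne
  obtain ⟨hfar, hwrap⟩ := cyclicFar_of_arcColour_eq c hc (by omega) hlt (arcIdx_lt hs hM hw) hcc
  -- direct way and wrap-around way
  have h1 : N * (2 * m + 2 - 1) < (w - v) * M := mul_gt_of_arcIdx_le hvw hN (by omega) (by omega)
  have h2 : N * (2 * m + 2 - 1) < (N - (w - v)) * M := mul_gt_of_arcIdx_wrap hvw hw hN (by omega) (by omega)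
  have h21 : 2 * m + 2 - 1 = 2 * m + 1 := by omega
  rw [h21] at h1 h2
  -- if `t < m s` then `t·M < m s·M ≤ m (N + s − 1) ≤ N (2m+1)`: contradiction
  have aux : ∀ t : ℕ, N * (2 * m + 1) < t * M → m * s ≤ t := by
    intro t ht
    by_contra hlt'
    have hlt'' : t + 1 ≤ m * s := Nat.lt_of_not_le hlt'
    have h3 : t * M + M ≤ m * s * M := by
      have := Nat.mul_le_mul_right M hlt''
      rw [Nat.add_mul, Nat.one_mul] at this
      exact this
    have h4 : m * s * M ≤ m * (N + s - 1) := by rw [mul_assoc]; exact Nat.mul_le_mul_left _ hMs'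
    have h5 : m * (N + s - 1) ≤ m * (2 * N) := Nat.mul_le_mul_left _ (by omega)
    have h6 : m * (2 * N) + N = N * (2 * m + 1) := by ring
    omega
  exact ⟨aux _ h1, aux _ h2⟩

/-- **One coordinate.**  If the integers `a, b` are cyclically `s`-separated on `ℤ/N` (`1 ≤ s ≤ N`),
`s ≤ |valMinAbs((a − b : ℤ) : ZMod N)|`, and their residues have the same arc colour (period `2m+2`), then they are
cyclically `m·s`-separated: `m·s ≤ |valMinAbs((a − b : ℤ) : ZMod N)|`. [folklore] -/
theorem sep_mul_of_coordColour_eq {N s m M : ℕ} [NeZero N] (hs : 1 ≤ s) (hsN : s ≤ N) (hM : M = (N + s - 1) / s)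
    (c : ℕ → ℕ)
    (hc : ∀ j, c j = if j < M - M % (2 * m + 2) then j % (2 * m + 2) else (2 * m + 2) + (j - (M - M % (2 * m + 2))))
    {a b : ℤ} (hsep : (s : ℤ) ≤ |((((a - b : ℤ) : ZMod N)).valMinAbs : ℤ)|)
    (hcc : c ((a : ZMod N).val * M / N) = c ((b : ZMod N).val * M / N)) :
    ((m * s : ℕ) : ℤ) ≤ |((((a - b : ℤ) : ZMod N)).valMinAbs : ℤ)| := by
  set z : ZMod N := (a : ZMod N) with hz
  set w : ZMod N := (b : ZMod N) with hw
  have hcast : ((a - b : ℤ) : ZMod N) = z - w := by push_cast; rw [hz, hw]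
  rw [hcast] at hsep ⊢
  rw [Int.abs_eq_natAbs] at hsep ⊢
  rw [natAbs_valMinAbs_sub_eq_min] at hsep ⊢
  have hzN := z.val_lt
  have hwN := w.val_lt
  rcases le_total z.val w.val with h | h
  · have hd : Int.natAbs ((z.val : ℤ) - w.val) = w.val - z.val := by omega
    rw [hd] at hsep ⊢
    have hsepN : s ≤ min (w.val - z.val) (N - (w.val - z.val)) := by exact_mod_cast hsep
    obtain ⟨h1, h2⟩ := far_vals_of_colour_eq hs hsN hM c hc h hwN (le_min_iff.1 hsepN).1 hcc
    exact_mod_cast le_min h1 h2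
  · have hd : Int.natAbs ((z.val : ℤ) - w.val) = z.val - w.val := by omega
    rw [hd] at hsep ⊢
    have hsepN : s ≤ min (z.val - w.val) (N - (z.val - w.val)) := by exact_mod_cast hsep
    obtain ⟨h1, h2⟩ := far_vals_of_colour_eq hs hsN hM c hc h hzN (le_min_iff.1 hsepN).1 hcc.symm
    exact_mod_cast le_min h1 h2

/-! ## §5 Four coordinates -/

/-- **Sparsification of a separated family.**  On `(ℤ/N)⁴` with `1 ≤ s ≤ N`: two sites that are cyclically `s`-separated in
some coordinate and whose residues carry the same arc colour in EVERY coordinate are cyclically `m·s`-separated in some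
coordinate.  (By `arcColour_lt`/`arcIdx_lt` the colour vector lives in `{0,…,4m+3}⁴`: at most `(4m+4)⁴` classes.) [folklore] -/
theorem sparse_of_colour_eq {N s m M : ℕ} [NeZero N] (hs : 1 ≤ s) (hsN : s ≤ N) (hM : M = (N + s - 1) / s) (c : ℕ → ℕ)
    (hc : ∀ j, c j = if j < M - M % (2 * m + 2) then j % (2 * m + 2) else (2 * m + 2) + (j - (M - M % (2 * m + 2))))
    {y y' : Fin 4 → ℤ} (hsep : ∃ k : Fin 4, (s : ℤ) ≤ |((((y k - y' k : ℤ) : ZMod N)).valMinAbs : ℤ)|)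
    (hcol : ∀ k : Fin 4, c (((y k : ℤ) : ZMod N).val * M / N) = c (((y' k : ℤ) : ZMod N).val * M / N)) :
    ∃ k : Fin 4, ((m * s : ℕ) : ℤ) ≤ |((((y k - y' k : ℤ) : ZMod N)).valMinAbs : ℤ)| := by
  obtain ⟨k, hk⟩ := hsep
  exact ⟨k, sep_mul_of_coordColour_eq hs hsN hM c hc hk (hcol k)⟩

end Summit.QuantumFields.YangMills.Cruxes.UVSeamRec.ResponsePinning.Sparse
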